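import Mathlib
import Summits.NavierStokesRegularity.NavierStokesRegularity.Theorems.FilamentSkeletonRssAreaLawSlavingHoloReal

/-!
# Area-law slaving, complex part 4 — the COMPLEXIFIED AREA LAW `w·A′ = (3/2 − w′)·A + 4` on a convex domain
# (`FilamentSkeletonRss`, child crux `TangentSkeletonNearStraight`, stmt-NavierStokesRegularity-28295, line
# `child_tangent_analytic_strip`, ∃-side of the registered stub `stub_analyticClosing`: the `StadiumAnalyticArea` conjunct)

Parts 1–3 (`Theorems.AreaLawSlavingHolo.*`) solve the abstract singular equation `(z − c)·A′ = a·A + b` holomorphically, at a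
real singular point of a convex domain, with a solution real on the real trace.  This file writes the result in the vocabulary of
the crux (`FlatJ1G`'s area-law conjunct `w·Aa′ = (3/2 − w′)·Aa + 4`, regular value `Aa(c) = 4/(w′(c) − 3/2)`): for a slip `w`
HOLOMORPHIC on an open convex `U` (the stadium), real on the real trace, with a zero at the real point `c`, supercritical there
(`Re w′(c) > 3/2`) and no other zero in `U`, the area law has a solution `G` HOLOMORPHIC ON `U`, real on the real trace, with
`G(c) = 4/(w′(c) − 3/2)`, and its real trace `x ↦ Re G(x)` solves the REAL area law against the real slip `x ↦ Re w(x)`.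
Mechanism: Hadamard factorisation `w(z) = (z − c)·g(z)` with `g` holomorphic, real on the trace and zero-free
(`slip_hadamard_factor`), then part 3 with `a = (3/2 − w′)/g`, `b = 4/g`, `ν = (w′(c) − 3/2)/w′(c)`.

* `slip_hadamard_factor` — the factorisation package;
* `areaLaw_holo` — the complexified area law and its real trace.

Left for the `StadiumAnalyticArea` conjunct (census): local uniqueness of the real area law on the trace interval (to identify
`Re G` with the slaved area of `Theorems.AreaLawSlaving` part 2 — or take `Aa := Re G` near the ball and check the global clauses),
zero-freeness of the continued slip on a thin stadium (Rouché at `c`, slip floor + Cauchy bound elsewhere), and the factor-two window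
`Aa/2 ≤ Re G`, `|G| ≤ 2·Aa`.

HONEST FRAMING: classical complex analysis serving a HYPOTHETICAL filament skeleton on the NEGATIVE side of a MODEL route; no
registered stub is closed by this file and nothing here bears on Navier–Stokes regularity or blow-up.
`--supports stmt-NavierStokesRegularity-28295`.
-/

set_option linter.dupNamespace false

noncomputable section

namespace Summit.NavierStokesRegularity.NavierStokesRegularity.Theorems.AreaLawSlavingHolo

open Set MeasureTheory Metric Filter
open scoped Topology

/-- The quotient of two complex numbers with zero imaginary parts has zero imaginary part. [folklore] -/
theorem im_div_eq_zero {p q : ℂ} (hp : p.im = 0) (hq : q.im = 0) : (p / q).im = 0 := by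
  rw [Complex.div_im, hp, hq]; ring

/-- **Hadamard factorisation of a holomorphic slip at a real zero.**  `U` open convex, `c : ℝ` with `↑c ∈ U`, `w` holomorphic
on `U`, real on the real trace, `w(c) = 0`.  Then there is `g` holomorphic on `U`, real on the real trace, with
`w(z) = (z − c)·g(z)` on `U` and `g(c) = w′(c)`; if moreover `w′(c) ≠ 0` and `w` has no other zero in `U`, then `g` is zero-free
on `U`. [folklore] -/
theorem slip_hadamard_factor {U : Set ℂ} (hUo : IsOpen U) (hUc : Convex ℝ U) {c : ℝ} (hc : (c : ℂ) ∈ U) {w : ℂ → ℂ}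
    (hw : DifferentiableOn ℂ w U) (hw_re : ∀ x : ℝ, (x : ℂ) ∈ U → (w x).im = 0) (hwc : w c = 0) :
    ∃ g : ℂ → ℂ, DifferentiableOn ℂ g U ∧ (∀ x : ℝ, (x : ℂ) ∈ U → (g x).im = 0) ∧
      (∀ z ∈ U, w z = (z - c) * g z) ∧ g c = deriv w c ∧
      ((deriv w c ≠ 0) → (∀ z ∈ U, z ≠ c → w z ≠ 0) → ∀ z ∈ U, g z ≠ 0) := by
  set V : Set ℂ := (fun z => z - (c : ℂ)) '' U with hV
  have hVo : IsOpen V := isOpen_image_sub hUo c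
  have hstar := star_of_convex hUc hc
  have hmemV : ∀ z ∈ U, z - (c : ℂ) ∈ V := fun z hz => ⟨z, hz, rfl⟩
  -- the translated slip
  set wt : ℂ → ℂ := fun u => w (u + c) with hwt
  have hwtD : DifferentiableOn ℂ wt V := by
    refine (hw.comp ((differentiable_id.add_const (c : ℂ)).differentiableOn) ?_)
    rintro _ ⟨u, hu, rfl⟩; simpa using hu
  have hwt'D : DifferentiableOn ℂ (deriv wt) V := (hwtD.analyticOnNhd hVo).deriv.differentiableOn
  have hwt_re : ∀ x : ℝ, (x : ℂ) ∈ V → (wt x).im = 0 := by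
    intro x hx
    obtain ⟨u, hu, hux⟩ := hx
    have : (x : ℂ) + c = ((x + c : ℝ) : ℂ) := by push_cast; ring
    simp only [hwt, this]
    refine hw_re (x + c) ?_
    have hu' : u = ((x + c : ℝ) : ℂ) := by push_cast; rw [← hux]; ring
    rw [← hu']; exact hu
  have hwt0 : deriv wt 0 = deriv w c := by
    have h1 : HasDerivAt w (deriv w c) ((0:ℂ) + c) := by
      rw [zero_add]; exact (hw.differentiableAt (hUo.mem_nhds hc)).hasDerivAt
    have h2 := h1.comp (0:ℂ) ((hasDerivAt_id (0:ℂ)).add_const (c : ℂ))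
    simp only [mul_one] at h2
    exact h2.deriv
  -- the Hadamard quotient
  have hw1 : IntervalIntegrable (fun _ : ℝ => (1:ℝ)) volume 0 1 := intervalIntegrable_const
  set g : ℂ → ℂ := fun z => ∫ t in (0:ℝ)..1, deriv wt ((t : ℂ) * (z - c)) with hg
  have hID : DifferentiableOn ℂ (fun u => ∫ t in (0:ℝ)..1, deriv wt ((t : ℂ) * u)) V := by
    have := differentiableOn_integral_weight_comp_mul hVo hstar hwt'D hw1
    simp only [Complex.ofReal_one, one_mul] at this
    exact this
  have hgD : DifferentiableOn ℂ g U :=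
    hID.comp ((differentiable_id.sub_const (c : ℂ)).differentiableOn) fun z hz => hmemV z hz
  have hg_re : ∀ x : ℝ, (x : ℂ) ∈ U → (g x).im = 0 := by
    intro x hx
    have e : (x : ℂ) - (c : ℂ) = ((x - c : ℝ) : ℂ) := by push_cast; ring
    simp only [hg, e]
    have h := im_integral_weight_eq_zero (g := deriv wt) (x := x - c) (fun _ => (1:ℝ)) (fun t ht => by
      have e2 : (t : ℂ) * ((x - c : ℝ) : ℂ) = ((t * (x - c) : ℝ) : ℂ) := by push_cast; ring
      rw [e2]
      refine im_deriv_eq_zero_of_real_trace hVo hwtD hwt_re ?_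
      have : ((t * (x - c) : ℝ) : ℂ) = (t : ℂ) * ((x : ℂ) - c) := by push_cast; ring
      rw [this]; exact hstar _ (hmemV _ hx) t ht)
    simpa using h
  have hfac : ∀ z ∈ U, w z = (z - c) * g z := by
    intro z hz
    have h := mul_integral_deriv_comp_mul hVo hstar hwtD (hmemV z hz)
    simp only [hwt, sub_add_cancel, zero_add, hwc, sub_zero] at h
    simp only [hg]
    exact h.symm
  have hgc : g c = deriv w c := by
    simp only [hg, sub_self, mul_zero]
    rw [intervalIntegral.integral_const, sub_zero, one_smul, hwt0]
  refine ⟨g, hgD, hg_re, hfac, hgc, fun hd hz z hzU => ?_⟩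
  by_cases hzc : z = c
  · rw [hzc, hgc]; exact hd
  · intro hg0
    have := hfac z hzU
    rw [hg0, mul_zero] at this
    exact hz z hzU hzc this

/-- **The complexified area law on a convex domain.**  `U ⊆ ℂ` open convex; `c : ℝ` with `↑c ∈ U`; `w` holomorphic on `U`, real on
the real trace, `w(c) = 0`, SUPERCRITICAL (`Re w′(c) > 3/2`) and zero-free on `U ∖ {c}`.  Then there is `G` HOLOMORPHIC on `U`, REAL
on the real trace, solving the area law `w·G′ = (3/2 − w′)·G + 4` on `U` with the regular value `G(c) = 4/(w′(c) − 3/2)`, and its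
real trace `x ↦ Re G(x)` is differentiable and solves the REAL area law against the real slip `x ↦ Re w(x)`:
`Re w(x)·(Re G)′(x) = (3/2 − (Re w)′(x))·Re G(x) + 4` on `{x : ℝ | ↑x ∈ U}`. [Coddington–Levinson 1955, Ch. 4 §1; folklore] -/
theorem areaLaw_holo {U : Set ℂ} (hUo : IsOpen U) (hUc : Convex ℝ U) {c : ℝ} (hc : (c : ℂ) ∈ U) {w : ℂ → ℂ}
    (hw : DifferentiableOn ℂ w U) (hw_re : ∀ x : ℝ, (x : ℂ) ∈ U → (w x).im = 0) (hwc : w c = 0)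
    (hsup : 3 / 2 < (deriv w c).re) (hwz : ∀ z ∈ U, z ≠ c → w z ≠ 0) :
    ∃ G : ℂ → ℂ, DifferentiableOn ℂ G U ∧ (∀ x : ℝ, (x : ℂ) ∈ U → (G x).im = 0) ∧
      (∀ z ∈ U, w z * deriv G z = (3 / 2 - deriv w z) * G z + 4) ∧ G c = 4 / (deriv w c - 3 / 2) ∧
      ∀ x : ℝ, (x : ℂ) ∈ U →
        HasDerivAt (fun t : ℝ => (G t).re) ((deriv G x).re) x ∧
          (w x).re * deriv (fun t : ℝ => (G t).re) x = (3 / 2 - deriv (fun t : ℝ => (w t).re) x) * (G x).re + 4 := by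
  obtain ⟨g, hgD, hg_re, hfac, hgc, hgz'⟩ := slip_hadamard_factor hUo hUc hc hw hw_re hwc
  -- the derivative of the slip at `c` is real and exceeds `3/2`
  set d : ℝ := (deriv w c).re with hd
  have hd_im : (deriv w c).im = 0 := im_deriv_eq_zero_of_real_trace hUo hw hw_re hc
  have hdc : deriv w c = (d : ℂ) := Complex.ext (by simp [hd]) (by simp [hd_im])
  have hd32 : 3 / 2 < d := hsup
  have hd0 : 0 < d := by linarith
  have hdne : (d : ℂ) ≠ 0 := by exact_mod_cast hd0.ne'
  have hgz : ∀ z ∈ U, g z ≠ 0 := hgz' (by rw [hdc]; exact hdne) hwz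
  -- coefficients
  have hw'D : DifferentiableOn ℂ (deriv w) U := (hw.analyticOnNhd hUo).deriv.differentiableOn
  set a : ℂ → ℂ := fun z => (3 / 2 - deriv w z) / g z with ha
  set b : ℂ → ℂ := fun z => 4 / g z with hb
  have haD : DifferentiableOn ℂ a U := ((differentiableOn_const _).sub hw'D).div hgD hgz
  have hbD : DifferentiableOn ℂ b U := (differentiableOn_const _).div hgD hgz
  have ha_re : ∀ x : ℝ, (x : ℂ) ∈ U → (a x).im = 0 := by
    intro x hx
    simp only [ha]
    refine im_div_eq_zero ?_ (hg_re x hx)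
    rw [Complex.sub_im, im_deriv_eq_zero_of_real_trace hUo hw hw_re hx]; norm_num
  have hb_re : ∀ x : ℝ, (x : ℂ) ∈ U → (b x).im = 0 := by
    intro x hx
    simp only [hb]
    exact im_div_eq_zero (by norm_num) (hg_re x hx)
  set ν : ℝ := (d - 3 / 2) / d with hν
  have hνpos : 0 < ν := div_pos (by linarith) hd0
  have hac : a c = -ν := by
    simp only [ha, hν, hgc, hdc]
    push_cast
    field_simp
    ring
  obtain ⟨G, hGD, hODE, hGc, hG_re⟩ :=
    singular_regular_solution_holo_at_real hUo hUc hc hνpos haD hbD hac ha_re hb_re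
  -- the area law
  have hlaw : ∀ z ∈ U, w z * deriv G z = (3 / 2 - deriv w z) * G z + 4 := by
    intro z hz
    have h1 := hODE z hz
    have hgz1 := hgz z hz
    rw [hfac z hz]
    calc (z - c) * g z * deriv G z = g z * ((z - c) * deriv G z) := by ring
      _ = g z * (a z * G z + b z) := by rw [h1]
      _ = (3 / 2 - deriv w z) * G z + 4 := by
          simp only [ha, hb]
          field_simp
  have hGc' : G c = 4 / (deriv w c - 3 / 2) := by
    rw [hGc]
    simp only [hb, hgc, hdc, hν]
    have h32 : (d : ℂ) - 3 / 2 ≠ 0 := by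
      have : ((d - 3 / 2 : ℝ) : ℂ) ≠ 0 := by exact_mod_cast (by linarith : d - 3 / 2 ≠ 0)
      push_cast at this; exact this
    push_cast
    field_simp
  refine ⟨G, hGD, hG_re, hlaw, hGc', fun x hx => ?_⟩
  have hGd := hasDerivAt_re_trace hUo hGD hx
  have hwd := hasDerivAt_re_trace hUo hw hx
  refine ⟨hGd, ?_⟩
  rw [hGd.deriv, hwd.deriv]
  -- real parts of the complex area law at the real point `x`
  have hG'im : (deriv G x).im = 0 := im_deriv_eq_zero_of_real_trace hUo hGD hG_re hx
  have h := congrArg Complex.re (hlaw x hx)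
  simp only [Complex.mul_re, Complex.add_re, Complex.sub_re, hG'im, hw_re x hx, hG_re x hx, mul_zero,
    sub_zero] at h
  norm_num at h
  linarith

end Summit.NavierStokesRegularity.NavierStokesRegularity.Theorems.AreaLawSlavingHolo
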